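import Mathlib
import HarnessLib
import Summits.Langlands.Statement
import Literature.NumberTheory.Automorphic.AutomorphicRepsGLSatakeFlathProofs
import Literature.NumberTheory.GaloisRepresentations.ResidualPairIntegrality
import Literature.FieldTheory.AlgClosed.PadicAlgClEquivComplex
import Literature.NumberTheory.PAdicHodge.FontaineDpst
import Literature.NumberTheory.Automorphic.GLnAdelicStructureProofs
import Literature.NumberTheory.Automorphic.LocalLanglandsGLProofs
import Literature.NumberTheory.Automorphic.LocalConstantsProofs

/-!
# Satake-family reach vocabulary (definitions only): full / anchored compatible Satake families, the residual-
# congruence graph, solvable links, and the solvable-point doors of rank 2 — the vocabulary of the Langlands routes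
# CongruenceGraphSplit rev 1 · SolvableReachSplit rev 0, sorry-free, no `Theses` import

This file contains DEFINITIONS ONLY (no theorems, no new mathematics).  It lands, as tree declarations, the
structured predicates that the route files `Theses/CongruenceGraphSplit.lean` (items `InsolubleComponentAnchor`
26848, `SolvableVertexAnchor` 26849, `DoorlessComponentAnchor` 28160, `KleinDoorReach` 28159) and
`Theses/SolvableReachSplit.lean` (item `SolvableReach` 29340) spell out INLINE, so that further statement items
of these routes (the layer-2 children `SolDoorReach` / `ProjectivelyLargeReach` of `SolvableReach`, refused by
the gate at 15 089 / 15 117 characters as inlined one-liners; and the lens-3 g6 items) can be written as SHORT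
one-line Props over these declarations.  Every definition below is VERBATIM the `section Vocabulary` of the
cleared lens-3 g5 node `nodes/lens-3-g5-SolvableReachSplit.lean` (sha256 6a752ba4…; decomp-langlands critic
CLEARED 2026-08-30T06:26:59Z, CRITIC-LEDGER row 59), whose `…_iff := Iff.rfl` theorems certify that the tree
items ARE these readings; nothing is restated with a different meaning.

Imports: `Mathlib`, `HarnessLib`, `Summits.Langlands.Statement` and Literature modules only — NO `Summits.….Theses.*`
import, so every route / Theorems file may import this module without an import cycle.  Placement: problem-posited
VOCABULARY under `Summits/<P>/<Sub>/Theorems` (planner.md §4; the writer's ask STATUS L256); the Literature placement was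
tried first (item defn-SatakeFamilyReach) and bounced by the Literature lint `literature-cited-only` (route vocabulary is
not a published notion).  The advisory file audit classes the 14 predicates `tree.vendored-fact` (untagged Prop-valued
defs under `Summit.*`): they restate NO literature fact — they are definitions consumed by registered obligations
(items 26848, 26849, 28159, 28160, 29340 and the layer-2 children of 29340).  Background: compatible systems and residual
congruences [cite: KhareWintenberger2009, §1]; solvable-point doors [cite: ShepherdBarronTaylor1997, §1]
[cite: Ellenberg2005, §2.4], Manoharmayum (Math. Res. Lett. 8, 2001).

Contents (namespace `Summit.Langlands.Langlands.Theorems.SatakeFamilyReach`):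
`Full` · `Anchored` · `Adj` · `Linked` · `Small` · `KReach` · `Link` · `LReach` · `Reach` · `KleinDoor` ·
`ModDoorBase` · `ModDoorSolv` · `ArtinDoor` · `SolDoor`.
-/

set_option linter.dupNamespace false
set_option linter.unusedVariables false

namespace Summit.Langlands.Langlands.Theorems.SatakeFamilyReach

open scoped Valued
open Filter

section Vocabulary

variable {K : Type} [Field K] [NumberField K]

/-- FULL Satake family of rank `n` over `K` (hypothesis of `FamilyAnchor`, verbatim). -/
def Full (K : Type) [Field K] [NumberField K] (n : ℕ)
    (a : IsDedekindDomain.HeightOneSpectrum (NumberField.RingOfIntegers K) → Multiset ℂ) : Prop :=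
  (∀ (ℓ : ℕ) [Fact ℓ.Prime] (ι : PadicAlgCl ℓ ≃+* ℂ), ∃ ρ : Literature.NumberTheory.GaloisRepresentations.FramedGaloisRep K (PadicAlgCl ℓ) n, ρ.toGaloisRep.IsIrreducible ∧ (∀ᶠ v : IsDedekindDomain.HeightOneSpectrum (NumberField.RingOfIntegers K) in cofinite, ρ.IsUnramifiedAt v) ∧ (∀ (v : IsDedekindDomain.HeightOneSpectrum (NumberField.RingOfIntegers K)) (hv : ((ℓ : ℕ) : NumberField.RingOfIntegers K) ∈ v.asIdeal), (Literature.NumberTheory.PAdicHodge.fontainePstAdicCompletion v ℓ hv).IsDeRhamFramed (ρ.toLocal v)) ∧ ∀ᶠ v : IsDedekindDomain.HeightOneSpectrum (NumberField.RingOfIntegers K) in cofinite, ρ.HasFrobCharpolyAt v (Literature.NumberTheory.Automorphic.arithFrobPolyOfSatake ι v.residueCard 1 (a v)))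

/-- ANCHORED family (conclusion of `FamilyAnchor`, verbatim): a member at some prime is residually automorphic. -/
def Anchored (K : Type) [Field K] [NumberField K] (n : ℕ)
    (hcpt : Literature.NumberTheory.Automorphic.isCompact_glFiniteIntegralLevel n K)
    (a : IsDedekindDomain.HeightOneSpectrum (NumberField.RingOfIntegers K) → Multiset ℂ) : Prop :=
  ∃ (ℓ₀ : ℕ) (_ : Fact ℓ₀.Prime) (ι₀ : PadicAlgCl ℓ₀ ≃+* ℂ) (ρ₀ : Literature.NumberTheory.GaloisRepresentations.FramedGaloisRep K (PadicAlgCl ℓ₀) n) (π : Literature.NumberTheory.Automorphic.CuspidalAutomorphicRepData n K hcpt), ρ₀.toGaloisRep.IsIrreducible ∧ (∀ᶠ v : IsDedekindDomain.HeightOneSpectrum (NumberField.RingOfIntegers K) in cofinite, ρ₀.IsUnramifiedAt v) ∧ (∀ (v : IsDedekindDomain.HeightOneSpectrum (NumberField.RingOfIntegers K)) (hv : ((ℓ₀ : ℕ) : NumberField.RingOfIntegers K) ∈ v.asIdeal), (Literature.NumberTheory.PAdicHodge.fontainePstAdicCompletion v ℓ₀ hv).IsDeRhamFramed (ρ₀.toLocal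 v)) ∧ (∀ᶠ v : IsDedekindDomain.HeightOneSpectrum (NumberField.RingOfIntegers K) in cofinite, ρ₀.HasFrobCharpolyAt v (Literature.NumberTheory.Automorphic.arithFrobPolyOfSatake ι₀ v.residueCard 1 (a v))) ∧ π.1.IsLAlgebraic ∧ ∀ᶠ v : IsDedekindDomain.HeightOneSpectrum (NumberField.RingOfIntegers K) in cofinite, (∃ α : Multiset ℂ, π.1.HasSatakeParamAt v α) ∧ ∀ α : Multiset ℂ, π.1.HasSatakeParamAt v α → ∃ P Q : Polynomial (Valued.v : Valuation (PadicAlgCl ℓ₀) NNReal).valuationSubring, ρ₀.HasFrobCharpolyAt v (P.map (Valued.v : Valuation (PadicAlgCl ℓ₀) NNReal).valuationSubring.subtype) ∧ Literature.NumberTheory.Automorphic.arithFrobPolyOfSatake ι₀ v.residueCard 1 α = Q.map (Valued.v : Valuation (PadicAlgCl ℓ₀) NNReal).valuationSubring.subtype ∧ P.map (IsLocalRing.residue (Valued.v : Valuation (PadicAlgCl ℓ₀) NNReal).valuationSubring) = Q.map (IsLocalRing.residue (Valued.v : Valuation (PadicAlgCl ℓ₀) NNReal).valuationSubring)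

/-- EDGE of 𝒢(K, n): congruent ℤ̄_ℓ-integral ι-Satake polynomials at SOME prime ℓ, a.e. -/
def Adj (a a' : IsDedekindDomain.HeightOneSpectrum (NumberField.RingOfIntegers K) → Multiset ℂ) : Prop :=
  ∃ (ℓ : ℕ) (_ : Fact ℓ.Prime) (ι : PadicAlgCl ℓ ≃+* ℂ), ∀ᶠ v : IsDedekindDomain.HeightOneSpectrum (NumberField.RingOfIntegers K) in cofinite, ∃ Q Q' : Polynomial (Valued.v : Valuation (PadicAlgCl ℓ) NNReal).valuationSubring, Literature.NumberTheory.Automorphic.arithFrobPolyOfSatake ι v.residueCard 1 (a v) = Q.map (Valued.v : Valuation (PadicAlgCl ℓ) NNReal).valuationSubring.subtype ∧ Literature.NumberTheory.Automorphic.arithFrobPolyOfSatake ι v.residueCard 1 (a' v) = Q'.map (Valued.v : Valuation (PadicAlgCl ℓ) NNReal).valuationSubring.subtype ∧ Q.map (IsLocalRing.residue (Valued.v : Valuation (PadicAlgCl ℓ) NNReal).valuationSubring) = Q'.map (IsLocalRing.residue (Valued.v : Valuation (PadicAlgCl ℓ) NNReal).valuationSubring)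

/-- reachability in 𝒢(K, n) through FULL families. -/
def Linked (n : ℕ) (a a' : IsDedekindDomain.HeightOneSpectrum (NumberField.RingOfIntegers K) → Multiset ℂ) : Prop :=
  Relation.ReflTransGen (fun b b' : IsDedekindDomain.HeightOneSpectrum (NumberField.RingOfIntegers K) → Multiset ℂ => Full K n b' ∧ Adj b b') a a'

/-- SMALL = residually SOLUBLE at some prime (lattice-free; g3's solvability dial, verbatim). -/
def Small (n : ℕ) (a : IsDedekindDomain.HeightOneSpectrum (NumberField.RingOfIntegers K) → Multiset ℂ) : Prop :=
  (∃ (ℓ : ℕ) (_ : Fact ℓ.Prime) (ι : PadicAlgCl ℓ ≃+* ℂ) (ρ : Literature.NumberTheory.GaloisRepresentations.FramedGaloisRep K (PadicAlgCl ℓ) n), (∀ᶠ v : IsDedekindDomain.HeightOneSpectrum (NumberField.RingOfIntegers K) in cofinite, ρ.HasFrobCharpolyAt v (Literature.NumberTheory.Automorphic.arithFrobPolyOfSatake ι v.residueCard 1 (a v))) ∧ ∃ (L : Type) (_ : Field L) (_ : NumberField L) (_ : Algebra K L), IsGalois K L ∧ IsSolvable (L ≃ₐ[K] L) ∧ ∀ᶠ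 w : IsDedekindDomain.HeightOneSpectrum (NumberField.RingOfIntegers L) in cofinite, ∃ P : Polynomial (Valued.v : Valuation (PadicAlgCl ℓ) NNReal).valuationSubring, (ρ.restrictField L).HasFrobCharpolyAt w (P.map (Valued.v : Valuation (PadicAlgCl ℓ) NNReal).valuationSubring.subtype) ∧ P.map (IsLocalRing.residue (Valued.v : Valuation (PadicAlgCl ℓ) NNReal).valuationSubring) = (Polynomial.X - Polynomial.C 1) ^ n)

/-- ICA's conclusion: reach in 𝒢(K, n) to a small or anchored family. -/
def KReach (K : Type) [Field K] [NumberField K] (n : ℕ)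
    (hcpt : Literature.NumberTheory.Automorphic.isCompact_glFiniteIntegralLevel n K)
    (a : IsDedekindDomain.HeightOneSpectrum (NumberField.RingOfIntegers K) → Multiset ℂ) : Prop :=
  ∃ a' : IsDedekindDomain.HeightOneSpectrum (NumberField.RingOfIntegers K) → Multiset ℂ, Linked n a a' ∧ (Small n a' ∨ Anchored K n hcpt a')

/-- **NEW: the field-change edge** `Link K n a L b` — at every (ℓ, ι) a full-type member `R` of `a` over K whose
restriction to Γ_L is irreducible, a.e. unramified, pinned-de-Rham and reads the family `b` over L. -/
def Link (K : Type) [Field K] [NumberField K] (n : ℕ)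
    (a : IsDedekindDomain.HeightOneSpectrum (NumberField.RingOfIntegers K) → Multiset ℂ)
    (L : Type) [Field L] [NumberField L] [Algebra K L]
    (b : IsDedekindDomain.HeightOneSpectrum (NumberField.RingOfIntegers L) → Multiset ℂ) : Prop :=
  (∀ (ℓ : ℕ) [Fact ℓ.Prime] (ι : PadicAlgCl ℓ ≃+* ℂ), ∃ ρ : Literature.NumberTheory.GaloisRepresentations.FramedGaloisRep K (PadicAlgCl ℓ) n, ρ.toGaloisRep.IsIrreducible ∧ (∀ᶠ v : IsDedekindDomain.HeightOneSpectrum (NumberField.RingOfIntegers K) in cofinite, ρ.IsUnramifiedAt v) ∧ (∀ (v : IsDedekindDomain.HeightOneSpectrum (NumberField.RingOfIntegers K)) (hv : ((ℓ : ℕ) : NumberField.RingOfIntegers K) ∈ v.asIdeal), (Literature.NumberTheory.PAdicHodge.fontainePstAdicCompletion v ℓ hv).IsDeRhamFramed (ρ.toLocal v)) ∧ (∀ᶠ v : IsDedekindDomain.HeightOneSpectrum (NumberField.RingOfIntegers K) in cofinite, ρ.HasFrobCharpolyAt v (Literature.NumberTheory.Automorphic.arithFrobPolyOfSatake ι v.residueCard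 1 (a v))) ∧ (ρ.restrictField L).toGaloisRep.IsIrreducible ∧ (∀ᶠ w : IsDedekindDomain.HeightOneSpectrum (NumberField.RingOfIntegers L) in cofinite, (ρ.restrictField L).IsUnramifiedAt w) ∧ (∀ (w : IsDedekindDomain.HeightOneSpectrum (NumberField.RingOfIntegers L)) (hw : ((ℓ : ℕ) : NumberField.RingOfIntegers L) ∈ w.asIdeal), (Literature.NumberTheory.PAdicHodge.fontainePstAdicCompletion w ℓ hw).IsDeRhamFramed ((ρ.restrictField L).toLocal w)) ∧ ∀ᶠ w : IsDedekindDomain.HeightOneSpectrum (NumberField.RingOfIntegers L) in cofinite, (ρ.restrictField L).HasFrobCharpolyAt w (Literature.NumberTheory.Automorphic.arithFrobPolyOfSatake ι w.residueCard 1 (b w)))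

/-- **NEW: solvable-potential reach** — after ONE finite Galois SOLVABLE base change L/K the linked family reaches a
small or anchored family in 𝒢(L, n) (for every compact-level witness over L; they are all equal). -/
def LReach (K : Type) [Field K] [NumberField K] (n : ℕ)
    (a : IsDedekindDomain.HeightOneSpectrum (NumberField.RingOfIntegers K) → Multiset ℂ) : Prop :=
  ∃ (L : Type) (_ : Field L) (_ : NumberField L) (_ : Algebra K L), IsGalois K L ∧ IsSolvable (L ≃ₐ[K] L) ∧
    ∃ b : IsDedekindDomain.HeightOneSpectrum (NumberField.RingOfIntegers L) → Multiset ℂ, Link K n a L b ∧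
      ∀ hcptL : Literature.NumberTheory.Automorphic.isCompact_glFiniteIntegralLevel n L, KReach L n hcptL b

/-- Reach in the SOLVABLY SATURATED graph. -/
def Reach (K : Type) [Field K] [NumberField K] (n : ℕ)
    (hcpt : Literature.NumberTheory.Automorphic.isCompact_glFiniteIntegralLevel n K)
    (a : IsDedekindDomain.HeightOneSpectrum (NumberField.RingOfIntegers K) → Multiset ℂ) : Prop :=
  KReach K n hcpt a ∨ LReach K n a

/-- g4's Klein doors (FiveDoor ∨ TwoDoor), verbatim the door of REST 28160. -/
def KleinDoor (a : IsDedekindDomain.HeightOneSpectrum (NumberField.RingOfIntegers K) → Multiset ℂ) : Prop :=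
  (∃ (_ : Fact (Nat.Prime 5)) (ι : PadicAlgCl 5 ≃+* ℂ) (ρ : Literature.NumberTheory.GaloisRepresentations.FramedGaloisRep K (PadicAlgCl 5) 2) (θ : Literature.NumberTheory.GaloisRepresentations.FramedGaloisRep K (PadicAlgCl 5) 1) (k : Type) (_ : Field k) (_ : Fintype k) (_ : TopologicalSpace k) (_ : DiscreteTopology k) (j : ZMod 5 →+* k) (e : k →+* IsLocalRing.ResidueField (Valued.v : Valuation (PadicAlgCl 5) NNReal).valuationSubring) (ρ₀ : Literature.NumberTheory.GaloisRepresentations.FramedGaloisRep K k 2), Fintype.card k = 5 ∧ (∀ᶠ v : IsDedekindDomain.HeightOneSpectrum (NumberField.RingOfIntegers K) in cofinite, ρ.HasFrobCharpolyAt v (Literature.NumberTheory.Automorphic.arithFrobPolyOfSatake ι v.residueCard 1 (a v))) ∧ (∀ σ : Field.absoluteGaloisGroup K, ((Matrix.GeneralLinearGroup.det (ρ₀ σ) : kˣ) : k) = ((Literature.NumberTheory.GaloisRepresentations.modPCyclotomicCharacter K k 5 j σ : kˣ) : k)) ∧ (∀ᶠ v : IsDedekindDomain.HeightOneSpectrum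 (NumberField.RingOfIntegers K) in cofinite, ∃ (P : Polynomial (Valued.v : Valuation (PadicAlgCl 5) NNReal).valuationSubring) (c : (Valued.v : Valuation (PadicAlgCl 5) NNReal).valuationSubring) (t d : k), ρ.HasFrobCharpolyAt v (P.map (Valued.v : Valuation (PadicAlgCl 5) NNReal).valuationSubring.subtype) ∧ θ.HasFrobCharpolyAt v ((Polynomial.X - Polynomial.C c).map (Valued.v : Valuation (PadicAlgCl 5) NNReal).valuationSubring.subtype) ∧ ρ₀.HasFrobCharpolyAt v (Polynomial.X ^ 2 - Polynomial.C t * Polynomial.X + Polynomial.C d) ∧ P.map (IsLocalRing.residue (Valued.v : Valuation (PadicAlgCl 5) NNReal).valuationSubring) = Polynomial.X ^ 2 - Polynomial.C (e t * IsLocalRing.residue (Valued.v : Valuation (PadicAlgCl 5) NNReal).valuationSubring c) * Polynomial.X + Polynomial.C (e d * (IsLocalRing.residue (Valued.v : Valuation (PadicAlgCl 5) NNReal).valuationSubring c) ^ 2))) ∨ (∃ (ι : PadicAlgCl 2 ≃+* ℂ) (ρ : Literature.NumberTheory.GaloisRepresentations.FramedGaloisRep K (PadicAlgCl 2) 2)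 (θ : Literature.NumberTheory.GaloisRepresentations.FramedGaloisRep K (PadicAlgCl 2) 1) (k : Type) (_ : Field k) (_ : Fintype k) (_ : TopologicalSpace k) (_ : DiscreteTopology k) (e : k →+* IsLocalRing.ResidueField (Valued.v : Valuation (PadicAlgCl 2) NNReal).valuationSubring) (ρ₀ : Literature.NumberTheory.GaloisRepresentations.FramedGaloisRep K k 2), Fintype.card k = 4 ∧ (∀ᶠ v : IsDedekindDomain.HeightOneSpectrum (NumberField.RingOfIntegers K) in cofinite, ρ.HasFrobCharpolyAt v (Literature.NumberTheory.Automorphic.arithFrobPolyOfSatake ι v.residueCard 1 (a v))) ∧ (∀ σ : Field.absoluteGaloisGroup K, Matrix.GeneralLinearGroup.det (ρ₀ σ) = 1) ∧ (∀ᶠ v : IsDedekindDomain.HeightOneSpectrum (NumberField.RingOfIntegers K) in cofinite, ∃ (P : Polynomial (Valued.v : Valuation (PadicAlgCl 2) NNReal).valuationSubring) (c : (Valued.v : Valuation (PadicAlgCl 2) NNReal).valuationSubring) (t d : k), ρ.HasFrobCharpolyAt v (P.map (Valued.v : Valuation (PadicAlgCl 2) NNReal).valuationSubring.subtype) ∧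 θ.HasFrobCharpolyAt v ((Polynomial.X - Polynomial.C c).map (Valued.v : Valuation (PadicAlgCl 2) NNReal).valuationSubring.subtype) ∧ ρ₀.HasFrobCharpolyAt v (Polynomial.X ^ 2 - Polynomial.C t * Polynomial.X + Polynomial.C d) ∧ P.map (IsLocalRing.residue (Valued.v : Valuation (PadicAlgCl 2) NNReal).valuationSubring) = Polynomial.X ^ 2 - Polynomial.C (e t * IsLocalRing.residue (Valued.v : Valuation (PadicAlgCl 2) NNReal).valuationSubring c) * Polynomial.X + Polynomial.C (e d * (IsLocalRing.residue (Valued.v : Valuation (PadicAlgCl 2) NNReal).valuationSubring c) ^ 2)))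

/-- **NEW door 1/3 `ModDoorBase`** — at some prime a member is residually ≡ ρ₀ ⊗ θ with ρ₀ : Γ_K → GL₂(k),
|k| ∈ {4, 5, 7, 9}, NO determinant clause (⊋ both Klein doors). -/
def ModDoorBase (a : IsDedekindDomain.HeightOneSpectrum (NumberField.RingOfIntegers K) → Multiset ℂ) : Prop :=
  (∃ (ℓ : ℕ) (_ : Fact ℓ.Prime) (ι : PadicAlgCl ℓ ≃+* ℂ) (ρ : Literature.NumberTheory.GaloisRepresentations.FramedGaloisRep K (PadicAlgCl ℓ) 2) (θ : Literature.NumberTheory.GaloisRepresentations.FramedGaloisRep K (PadicAlgCl ℓ) 1) (k : Type) (_ : Field k) (_ : Fintype k) (_ : TopologicalSpace k) (_ : DiscreteTopology k) (e : k →+* IsLocalRing.ResidueField (Valued.v : Valuation (PadicAlgCl ℓ) NNReal).valuationSubring) (ρ₀ : Literature.NumberTheory.GaloisRepresentations.FramedGaloisRep K k 2), Fintype.card k ∈ ({4, 5, 7, 9} : Finset ℕ) ∧ (∀ᶠ v : IsDedekindDomain.HeightOneSpectrum (NumberField.RingOfIntegers K) in cofinite, ρ.HasFrobCharpolyAt v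 (Literature.NumberTheory.Automorphic.arithFrobPolyOfSatake ι v.residueCard 1 (a v))) ∧ (∀ᶠ v : IsDedekindDomain.HeightOneSpectrum (NumberField.RingOfIntegers K) in cofinite, ∃ (P : Polynomial (Valued.v : Valuation (PadicAlgCl ℓ) NNReal).valuationSubring) (c : (Valued.v : Valuation (PadicAlgCl ℓ) NNReal).valuationSubring) (t d : k), ρ.HasFrobCharpolyAt v (P.map (Valued.v : Valuation (PadicAlgCl ℓ) NNReal).valuationSubring.subtype) ∧ θ.HasFrobCharpolyAt v ((Polynomial.X - Polynomial.C c).map (Valued.v : Valuation (PadicAlgCl ℓ) NNReal).valuationSubring.subtype) ∧ ρ₀.HasFrobCharpolyAt v (Polynomial.X ^ 2 - Polynomial.C t * Polynomial.X + Polynomial.C d) ∧ P.map (IsLocalRing.residue (Valued.v : Valuation (PadicAlgCl ℓ) NNReal).valuationSubring) = Polynomial.X ^ 2 - Polynomial.C (e t * IsLocalRing.residue (Valued.v : Valuation (PadicAlgCl ℓ) NNReal).valuationSubring c) * Polynomial.X + Polynomial.C (e d * (IsLocalRing.residue (Valued.v : Valuation (PadicAlgCl ℓ) NNReal).valuationSubring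 c) ^ 2)))

/-- **NEW door 2/3 `ModDoorSolv`** — the same over a finite Galois SOLVABLE K′/K (for the restriction of the member):
«projective residual image conjugate into PGL₂(𝔽_q), q ∈ {4, 5, 7, 9}» (scalar-lifting and determinant obstructions
die over cyclic extensions). -/
def ModDoorSolv (a : IsDedekindDomain.HeightOneSpectrum (NumberField.RingOfIntegers K) → Multiset ℂ) : Prop :=
  (∃ (ℓ : ℕ) (_ : Fact ℓ.Prime) (ι : PadicAlgCl ℓ ≃+* ℂ) (ρ : Literature.NumberTheory.GaloisRepresentations.FramedGaloisRep K (PadicAlgCl ℓ) 2), (∀ᶠ v : IsDedekindDomain.HeightOneSpectrum (NumberField.RingOfIntegers K) in cofinite, ρ.HasFrobCharpolyAt v (Literature.NumberTheory.Automorphic.arithFrobPolyOfSatake ι v.residueCard 1 (a v))) ∧ ∃ (K' : Type) (_ : Field K') (_ : NumberField K') (_ : Algebra K K'), IsGalois K K' ∧ IsSolvable (K' ≃ₐ[K] K') ∧ ∃ (θ : Literature.NumberTheory.GaloisRepresentations.FramedGaloisRep K' (PadicAlgCl ℓ) 1) (k : Type) (_ : Field k) (_ : Fintype k) (_ : TopologicalSpace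 k) (_ : DiscreteTopology k) (e : k →+* IsLocalRing.ResidueField (Valued.v : Valuation (PadicAlgCl ℓ) NNReal).valuationSubring) (ρ₀ : Literature.NumberTheory.GaloisRepresentations.FramedGaloisRep K' k 2), Fintype.card k ∈ ({4, 5, 7, 9} : Finset ℕ) ∧ ∀ᶠ w : IsDedekindDomain.HeightOneSpectrum (NumberField.RingOfIntegers K') in cofinite, ∃ (P : Polynomial (Valued.v : Valuation (PadicAlgCl ℓ) NNReal).valuationSubring) (c : (Valued.v : Valuation (PadicAlgCl ℓ) NNReal).valuationSubring) (t d : k), (ρ.restrictField K').HasFrobCharpolyAt w (P.map (Valued.v : Valuation (PadicAlgCl ℓ) NNReal).valuationSubring.subtype) ∧ θ.HasFrobCharpolyAt w ((Polynomial.X - Polynomial.C c).map (Valued.v : Valuation (PadicAlgCl ℓ) NNReal).valuationSubring.subtype) ∧ ρ₀.HasFrobCharpolyAt w (Polynomial.X ^ 2 - Polynomial.C t * Polynomial.X + Polynomial.C d) ∧ P.map (IsLocalRing.residue (Valued.v : Valuation (PadicAlgCl ℓ) NNReal).valuationSubring) = Polynomial.X ^ 2 - Polynomial.C (e t * IsLocalRing.residue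 (Valued.v : Valuation (PadicAlgCl ℓ) NNReal).valuationSubring c) * Polynomial.X + Polynomial.C (e d * (IsLocalRing.residue (Valued.v : Valuation (PadicAlgCl ℓ) NNReal).valuationSubring c) ^ 2))

/-- **NEW door 3/3 `ArtinDoor`** — at some prime a member is residually congruent to a FINITE-IMAGE σ : Γ_K → GL₂(ℚ̄_ℓ)
(projectively icosahedral residual image at ANY prime, by Tate lifting; soluble finite images are Small anyway). -/
def ArtinDoor (a : IsDedekindDomain.HeightOneSpectrum (NumberField.RingOfIntegers K) → Multiset ℂ) : Prop :=
  (∃ (ℓ : ℕ) (_ : Fact ℓ.Prime) (ι : PadicAlgCl ℓ ≃+* ℂ) (ρ σ : Literature.NumberTheory.GaloisRepresentations.FramedGaloisRep K (PadicAlgCl ℓ) 2), (∀ᶠ v : IsDedekindDomain.HeightOneSpectrum (NumberField.RingOfIntegers K) in cofinite, ρ.HasFrobCharpolyAt v (Literature.NumberTheory.Automorphic.arithFrobPolyOfSatake ι v.residueCard 1 (a v))) ∧ (Set.range (fun g : Field.absoluteGaloisGroup K => σ g)).Finite ∧ ∀ᶠ v : IsDedekindDomain.HeightOneSpectrum (NumberField.RingOfIntegers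 K) in cofinite, ∃ P Q : Polynomial (Valued.v : Valuation (PadicAlgCl ℓ) NNReal).valuationSubring, ρ.HasFrobCharpolyAt v (P.map (Valued.v : Valuation (PadicAlgCl ℓ) NNReal).valuationSubring.subtype) ∧ σ.HasFrobCharpolyAt v (Q.map (Valued.v : Valuation (PadicAlgCl ℓ) NNReal).valuationSubring.subtype) ∧ P.map (IsLocalRing.residue (Valued.v : Valuation (PadicAlgCl ℓ) NNReal).valuationSubring) = Q.map (IsLocalRing.residue (Valued.v : Valuation (PadicAlgCl ℓ) NNReal).valuationSubring))

/-- the SOLVABLE-POINT door. -/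
def SolDoor (a : IsDedekindDomain.HeightOneSpectrum (NumberField.RingOfIntegers K) → Multiset ℂ) : Prop :=
  ModDoorBase a ∨ ModDoorSolv a ∨ ArtinDoor a

end Vocabulary

end Summit.Langlands.Langlands.Theorems.SatakeFamilyReach
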